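import Summits.BirchSwinnertonDyer.BirchSwinnertonDyer.Theorems.CyclotomicUntwistSigmaLineFamilyConvergence
import Literature.NumberTheory.EllipticCurves.PadicSigmaVariableChangeProofs
import HarnessLib

/-!
# Route `CyclotomicUntwist`, crux K1 `PSRankOneLowerHalfAtThree` (stmt-BirchSwinnertonDyer-21580):
# the σ-LINE FAMILY — THE DILATED MAZUR–TATE PAIR: after the scaling `(x, y) = (p⁴x′, p⁶y′)` every
# `p`-integral Weierstrass curve over `ℚ_p` (ANY reduction type, e.g. ADDITIVE) carries Mazur–Tate sigma
# pairs in the tree's sense — one for each member `σ_c`, `c ∈ ℤ_p`, of the formal sigma family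

Cell `pub/bsd-wall` (D-0145 line `route-BirchSwinnertonDyer-CyclotomicUntwist`), seat `bsd-line-cycu-p1`
g4 (K1 base). THEOREMS ONLY (no definition, no named fact, no `sorry`); helper `--supports` K1 =
stmt-BirchSwinnertonDyer-21580. Sequel of `…SigmaLineFamilyConvergence.lean` (crude Bernardi convergence
`σ_c(p²t) ∈ p²t·ℤ_p⟦t⟧`). BSD is not proved by this file and nothing here is evidence for or against
K1/K2.

WHY. The tree's sigma-function / canonical-`p`-adic-height API (`PadicSigma.lean`,
`CanonicalPAdicHeight*.lean`) is keyed on the receptacle `IsMazurTateSigmaPair σ c` — an INTEGRAL odd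
normalised solution of `x + c = −D(Dσ/σ)` — which is inhabited (Mazur–Tate 1991 / Blakestad–Grant 2023) at
good ORDINARY `p ≥ 5` only (tree `mazur_tate_sigma_existsUnique_holds`, `PadicSigmaThreeExistence`). At
the route's prime (`3`, ADDITIVE potentially supersingular reduction) no member `σ_c` of the family of the
minimal model is integral. This file shows that integrality is restored by a DILATION of the parameter:
for a model `V'` with `(p², 0, 0, 0) • V' = V` (i.e. `aᵢ(V') = p^{2i}aᵢ(V)`, parameters `z = p²·z'`),

* §1 `formalVariableChange_of_scaling` — the induced map of formal groups is EXACTLY `z' ↦ p²·z'`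
  (`θ = u·z` for a pure scaling), so `σ ∘ θ = rescale u σ`;
* §2 `coeffs_of_scaling`, `isIntegral_of_scaling` (`V'` is `p`-integral), **`formalSigma_of_scaling` :
  `formalSigma V' (p⁴c) = p⁻²·(formalSigma V c)(p²z')`** for EVERY `c` (transport of oddness and of the
  sigma equation along `θ`, tree `IsFormallyOdd.variableChange_subst` /
  `SatisfiesSigmaODE.variableChange_subst` with `c' = u²c`, and uniqueness on `V'`), and
  **`isMazurTateSigmaPair_of_scaling` : `(formalSigma V' (p⁴c), p⁴c)` IS a Mazur–Tate sigma pair of `V'`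
  for every `c ∈ ℤ_p`** (integrality = `exists_dilation_formalSigma`: `p⁻²σ_c(p²z') = z'·F(Θ(z'))`,
  `F = exp(pX)`, `Θ ∈ z'ℤ_p⟦z'⟧`); hence `exists_isMazurTateSigmaPair_of_scaling`,
  `isMazurTateSigmaPair_padicSigma_of_scaling` (the tree's CHOSEN pair of `V'` is genuine and is a member
  of the dilated family), `exists_scaling` (`V' := (p⁻², 0, 0, 0) • V`).

Consequences available BY NAME from the tree for `V'` (not restated): the formal theta identity
(`thetaLHS_eq_thetaRHS`), the division/duplication identities of `IsMazurTateSigmaPair`, and — for a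
`ℤ`-integral model over `ℚ` — the pointwise theta relation `σ(P+Q)σ(P−Q) = (x(Q)−x(P))σ(P)²σ(Q)²` on the
kernel of reduction (`padicSigmaAt_theta_of_thetaLHS_eq`), the analytic core of the quadraticity of
σ-heights; what does NOT transfer verbatim is the tree's admissible-locus bookkeeping, stated for
GLOBALLY MINIMAL models (`exists_isCanonical_of_thetaLHS_eq`), since `V'` is not minimal at `p`.
UNIQUENESS of the pair fails for `V'` (one pair per `c ∈ ℤ_p`), consistently with the tree's uniqueness
theorems (`unique_of_unbounded_formalLog`) assuming an ordinary-type hypothesis.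

References: Mazur–Tate, Duke Math. J. 62 (1991) §3, Thm. 3.1 (`σ` of weight one in `ω`); Mazur–Stein–Tate
2006 Thm. 1.3, §1; Bernardi 1981 §1; Silverman AEC III.1 Table 3.1, IV.1.
[cite: MazurTate1991, Thm. 3.1] [cite: MazurSteinTate2006, Thm. 1.3] [cite: SilvermanAEC2009, IV.1.1]
-/

set_option autoImplicit false
-- single-conjunct summit: `Summit.BirchSwinnertonDyer.BirchSwinnertonDyer.…` repeats the name by design
set_option linter.dupNamespace false

noncomputable section

open scoped Classical

open PowerSeries WeierstrassCurve Literature.NumberTheory.EllipticCurves Literature.RingTheory.FormalGroups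
  Summit.BirchSwinnertonDyer.BirchSwinnertonDyer.Theorems.PSSigmaLineFamily
  Summit.BirchSwinnertonDyer.BirchSwinnertonDyer.Theorems.PSSigmaLineFamilyEvaluation
  Summit.BirchSwinnertonDyer.BirchSwinnertonDyer.Theorems.PSSigmaLineFamilyConvergence

namespace Summit.BirchSwinnertonDyer.BirchSwinnertonDyer.Theorems.PSSigmaLineFamilyDilatedPair

variable {p : ℕ} [Fact p.Prime]

/-! ### §1 Pure scalings `(u, 0, 0, 0)`: the induced map of formal groups is `z ↦ u·z` -/

section Scaling

variable {R : Type*} [CommRing R] (W : WeierstrassCurve R) (vc : VariableChange R)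

/-- For a pure scaling (`r = s = t = 0`) the denominator of `θ` is `1`. [Silverman AEC III.1] [folklore] -/
theorem formalVariableChangeDenom_of_scaling (hr : vc.r = 0) (hs : vc.s = 0) (ht : vc.t = 0) :
    W.formalVariableChangeDenom vc = 1 := by
  rw [formalVariableChangeDenom, hr, hs, ht, mul_zero, sub_zero, map_zero, zero_mul, zero_mul, add_zero, add_zero]

/-- **For a pure scaling `θ(z) = u·z` exactly** (`x = u²x'`, `y = u³y'`, `z' = −x'/y' = u·z`).
[Silverman AEC III.1, IV.1] [folklore] -/
theorem formalVariableChange_of_scaling (hr : vc.r = 0) (hs : vc.s = 0) (ht : vc.t = 0) :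
    W.formalVariableChange vc = C (vc.u : R) * X := by
  have h := W.formalVariableChange_mul_denom vc
  rwa [formalVariableChangeDenom_of_scaling W vc hr hs ht, mul_one, hr, map_zero, zero_mul, sub_zero] at h

/-- Substituting `θ = u·z` is rescaling by `u`. [folklore] -/
theorem subst_formalVariableChange_of_scaling (hr : vc.r = 0) (hs : vc.s = 0) (ht : vc.t = 0)
    (f : R⟦X⟧) : f.subst (W.formalVariableChange vc) = rescale (vc.u : R) f := by
  rw [formalVariableChange_of_scaling W vc hr hs ht, rescale_eq_subst, smul_eq_C_mul]

end Scaling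

/-! ### §2 The `p²`-dilated model: coefficients `aᵢ' = p^{2i}aᵢ`, hence `p`-integral -/

section Dilated

variable (V V' : WeierstrassCurve ℚ_[p]) (vc : VariableChange ℚ_[p])

/-- The coefficients of a model `V'` with `(u,0,0,0) • V' = V`: `aᵢ(V') = uⁱ·aᵢ(V)`. [Silverman AEC III.1 Table 3.1] [folklore] -/
theorem coeffs_of_scaling (hr : vc.r = 0) (hs : vc.s = 0) (ht : vc.t = 0) (hV : vc • V' = V) :
    V'.a₁ = (vc.u : ℚ_[p]) * V.a₁ ∧ V'.a₂ = (vc.u : ℚ_[p]) ^ 2 * V.a₂ ∧ V'.a₃ = (vc.u : ℚ_[p]) ^ 3 * V.a₃ ∧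
      V'.a₄ = (vc.u : ℚ_[p]) ^ 4 * V.a₄ ∧ V'.a₆ = (vc.u : ℚ_[p]) ^ 6 * V.a₆ := by
  subst hV
  have hu : (vc.u : ℚ_[p]) * (vc.u⁻¹ : ℚ_[p]ˣ) = 1 := by simp
  simp only [variableChange_def, hr, hs, ht]
  refine ⟨?_, ?_, ?_, ?_, ?_⟩ <;>
  · simp only [mul_zero, add_zero, sub_zero, zero_mul, zero_pow two_ne_zero, zero_pow three_ne_zero,
      Units.val_inv_eq_inv_val]
    field_simp

variable [V.IsIntegral ℤ_[p]]

/-- **The `p²`-dilated model is `p`-integral** (`aᵢ' = p^{2i}aᵢ`). [folklore] -/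
theorem isIntegral_of_scaling (hu : (vc.u : ℚ_[p]) = (p : ℚ_[p]) ^ 2) (hr : vc.r = 0) (hs : vc.s = 0)
    (ht : vc.t = 0) (hV : vc • V' = V) : V'.IsIntegral ℤ_[p] := by
  obtain ⟨h₁, h₂, h₃, h₄, h₆⟩ := coeffs_of_scaling V V' vc hr hs ht hV
  obtain ⟨n₁, n₂, n₃, n₄, n₆⟩ := V.norm_coeffs_le_one
  have hp : ‖(p : ℚ_[p])‖ ≤ 1 := by
    rw [Padic.norm_p]; exact inv_le_one_of_one_le₀ (by exact_mod_cast (Fact.out : p.Prime).one_le)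
  have hpk : ∀ k : ℕ, ‖((p : ℚ_[p]) ^ 2) ^ k‖ ≤ 1 := fun k => by
    rw [norm_pow, norm_pow]; exact pow_le_one₀ (by positivity) (pow_le_one₀ (norm_nonneg _) hp)
  have mem : ∀ {a : ℚ_[p]} (k : ℕ), ‖a‖ ≤ 1 → ((p : ℚ_[p]) ^ 2) ^ k * a ∈ PadicInt.subring p := by
    intro a k ha
    rw [PadicInt.mem_subring_iff, norm_mul]
    calc ‖((p : ℚ_[p]) ^ 2) ^ k‖ * ‖a‖ ≤ 1 * 1 := by gcongr; exact hpk k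
      _ = 1 := one_mul _
  refine isIntegral_of_mem_subring V' ?_ ?_ ?_ ?_ ?_
  · rw [h₁, hu, ← pow_one ((p : ℚ_[p]) ^ 2)]; exact mem 1 n₁
  · rw [h₂, hu]; exact mem 2 n₂
  · rw [h₃, hu]; exact mem 3 n₃
  · rw [h₄, hu]; exact mem 4 n₄
  · rw [h₆, hu]; exact mem 6 n₆

omit [V.IsIntegral ℤ_[p]] in
/-- **The dilated family IS the family of the dilated model**: for EVERY `c`,
`formalSigma V' (p⁴c) = p⁻²·(formalSigma V c)(p²z)` — transport of oddness and of the sigma equation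
along `θ(z) = p²z` (`c' = u²c`), plus uniqueness on `V'`. [Mazur–Tate 1991, §3 (weight of `σ` in `ω`);
Mazur–Stein–Tate 2006, §1] [cite: MazurSteinTate2006, Thm. 1.3] -/
theorem formalSigma_of_scaling (hu : (vc.u : ℚ_[p]) = (p : ℚ_[p]) ^ 2) (hr : vc.r = 0) (hs : vc.s = 0)
    (ht : vc.t = 0) (hV : vc • V' = V) (c : ℚ_[p]) :
    V'.formalSigma ((p : ℚ_[p]) ^ 4 * c) =
      C (((p : ℚ_[p]) ^ 2)⁻¹) * rescale ((p : ℚ_[p]) ^ 2) (V.formalSigma c) := by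
  have hp0 : (p : ℚ_[p]) ≠ 0 := by exact_mod_cast (Fact.out : p.Prime).ne_zero
  have h0 := constantCoeff_formalSigma V c
  have h1 := coeff_one_formalSigma V c
  have hodd : (vc • V').IsFormallyOdd (V.formalSigma c) := by rw [hV]; exact isFormallyOdd_formalSigma V c
  have hODE : (vc • V').SatisfiesSigmaODE (V.formalSigma c) c := by
    rw [hV]; exact satisfiesSigmaODE_formalSigma V c
  have hodd' := hodd.variableChange_subst ((vc.u⁻¹ : ℚ_[p]ˣ) : ℚ_[p])
  have hODE' := SatisfiesSigmaODE.variableChange_subst (V := V') (vc := vc) h0 h1 hODE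
  have huinv : ((vc.u⁻¹ : ℚ_[p]ˣ) : ℚ_[p]) = ((p : ℚ_[p]) ^ 2)⁻¹ := by
    rw [Units.val_inv_eq_inv_val, hu]
  rw [subst_formalVariableChange_of_scaling V' vc hr hs ht, hu, huinv] at hodd' hODE'
  rw [hr, sub_zero] at hODE'
  have hc' : ((p : ℚ_[p]) ^ 2) ^ 2 * c = (p : ℚ_[p]) ^ 4 * c := by ring
  rw [hc'] at hODE'
  -- normalisation of the transported series
  have h0' : constantCoeff (C (((p : ℚ_[p]) ^ 2)⁻¹) * rescale ((p : ℚ_[p]) ^ 2) (V.formalSigma c)) = 0 := by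
    rw [map_mul, ← coeff_zero_eq_constantCoeff_apply (rescale _ _), coeff_rescale, pow_zero, one_mul,
      coeff_zero_eq_constantCoeff_apply, h0, mul_zero]
  have h1' : coeff 1 (C (((p : ℚ_[p]) ^ 2)⁻¹) * rescale ((p : ℚ_[p]) ^ 2) (V.formalSigma c)) = 1 := by
    rw [coeff_C_mul, coeff_rescale, pow_one, h1, mul_one, inv_mul_cancel₀ (pow_ne_zero 2 hp0)]
  exact (eq_formalSigma h0' h1' hodd' hODE').symm

/-- **THE DILATED MAZUR–TATE PAIR.** For a `p`-integral `V/ℚ_p` (ANY prime, ANY reduction type — in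
particular the minimal model of a curve with ADDITIVE reduction at `p`), a model `V'` with
`(p², 0, 0, 0) • V' = V` (`aᵢ(V') = p^{2i}aᵢ(V)`, parameter `z' = z/p²`… i.e. `z = p²z'`) and every
constant `c ∈ ℤ_p`: the transported sigma function `σ' = p⁻²·σ_c(p²z')` together with `c' = p⁴c` IS A
MAZUR–TATE SIGMA PAIR of `V'` in the tree's sense (`IsMazurTateSigmaPair`: `σ' ∈ z' + z'²ℤ_p⟦z'⟧` odd,
`c' ∈ ℤ_p`, `x' + c' = −D'(D'σ'/σ')`). Integrality is the crude Bernardi convergence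
(`isPadicInt_rescale_formalSigma`: `σ_c(p²t) ∈ p²t·ℤ_p⟦t⟧`). So the tree's `∃ pair`-keyed sigma-function
API (`isMazurTateSigmaPair_padicSigma`, `padicSigma_eq_formalSigma`, the formal theta identity, the
division identities) reaches additive primes through the dilated model; note that UNIQUENESS of the pair
fails there (one pair for each `c ∈ ℤ_p`), consistently with the tree's uniqueness theorems assuming
ordinary-type hypotheses. [Mazur–Tate 1991, §3, Thm. 3.1; Bernardi 1981, §1; Mazur–Stein–Tate 2006, Thm. 1.3]
[cite: MazurTate1991, Thm. 3.1] [cite: MazurSteinTate2006, Thm. 1.3] -/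
theorem isMazurTateSigmaPair_of_scaling (hu : (vc.u : ℚ_[p]) = (p : ℚ_[p]) ^ 2) (hr : vc.r = 0)
    (hs : vc.s = 0) (ht : vc.t = 0) (hV : vc • V' = V) {c : ℚ_[p]} (hc : ‖c‖ ≤ 1) :
    V'.IsMazurTateSigmaPair (V'.formalSigma ((p : ℚ_[p]) ^ 4 * c)) ((p : ℚ_[p]) ^ 4 * c) := by
  have hp0 : (p : ℚ_[p]) ≠ 0 := by exact_mod_cast (Fact.out : p.Prime).ne_zero
  have hp1 : ‖(p : ℚ_[p])‖ ≤ 1 := by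
    rw [Padic.norm_p]; exact inv_le_one_of_one_le₀ (by exact_mod_cast (Fact.out : p.Prime).one_le)
  obtain ⟨Θ, hΘ, hΘ0, hdil⟩ := exists_dilation_formalSigma V hc
  have hrep : V'.formalSigma ((p : ℚ_[p]) ^ 4 * c) = X * (rescale (p : ℚ_[p]) (exp ℚ_[p])).subst Θ := by
    rw [formalSigma_of_scaling V V' vc hu hr hs ht hV c, hdil, ← mul_assoc, ← mul_assoc, ← map_mul,
      inv_mul_cancel₀ (pow_ne_zero 2 hp0), map_one, one_mul]
  have hint : IsPadicInt (V'.formalSigma ((p : ℚ_[p]) ^ 4 * c)) := by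
    rw [hrep]
    exact IsPadicInt.powerSeries_X.mul
      (isPadicInt_rescale_exp.powerSeries_subst hΘ (HasSubst.of_constantCoeff_zero' hΘ0))
  refine ⟨constantCoeff_formalSigma V' _, coeff_one_formalSigma V' _, isPadicInt_iff_coeff.mp hint, ?_,
    isFormallyOdd_formalSigma V' _, satisfiesSigmaODE_formalSigma V' _⟩
  rw [norm_mul, norm_pow]
  calc ‖(p : ℚ_[p])‖ ^ 4 * ‖c‖ ≤ 1 ^ 4 * 1 := by gcongr
    _ = 1 := by norm_num

/-- Hence **the dilated model carries a Mazur–Tate pair** (existence in the tree's receptacle), at every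
prime and for every reduction type of the original `p`-integral model. [cite: MazurTate1991, Thm. 3.1]
[cite: MazurSteinTate2006, Thm. 1.3] -/
theorem exists_isMazurTateSigmaPair_of_scaling (hu : (vc.u : ℚ_[p]) = (p : ℚ_[p]) ^ 2) (hr : vc.r = 0)
    (hs : vc.s = 0) (ht : vc.t = 0) (hV : vc • V' = V) :
    ∃ σ : ℚ_[p]⟦X⟧, ∃ c : ℚ_[p], V'.IsMazurTateSigmaPair σ c :=
  ⟨_, _, isMazurTateSigmaPair_of_scaling V V' vc hu hr hs ht hV (c := 0) (by simp)⟩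

/-- So the tree's CHOSEN pair `(padicSigma V', padicSigmaConst V')` of the dilated model is a genuine
Mazur–Tate pair, and `padicSigma V'` is the member `formalSigma V' (padicSigmaConst V')` of the dilated
family (which constant is chosen is unspecified — the pairs are NOT unique here). [cite: MazurSteinTate2006, Thm. 1.3] -/
theorem isMazurTateSigmaPair_padicSigma_of_scaling (hu : (vc.u : ℚ_[p]) = (p : ℚ_[p]) ^ 2) (hr : vc.r = 0)
    (hs : vc.s = 0) (ht : vc.t = 0) (hV : vc • V' = V) :
    V'.IsMazurTateSigmaPair V'.padicSigma V'.padicSigmaConst ∧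
      V'.padicSigma = V'.formalSigma V'.padicSigmaConst :=
  ⟨V'.isMazurTateSigmaPair_padicSigma (exists_isMazurTateSigmaPair_of_scaling V V' vc hu hr hs ht hV),
    padicSigma_eq_formalSigma (exists_isMazurTateSigmaPair_of_scaling V V' vc hu hr hs ht hV)⟩

omit [V.IsIntegral ℤ_[p]] in
/-- **Existence of the dilated model**: `V' := (p⁻², 0, 0, 0) • V` satisfies `(p², 0, 0, 0) • V' = V`.
[Silverman AEC III.1] [folklore] -/
theorem exists_scaling :
    ∃ (V' : WeierstrassCurve ℚ_[p]) (vc : VariableChange ℚ_[p]),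
      (vc.u : ℚ_[p]) = (p : ℚ_[p]) ^ 2 ∧ vc.r = 0 ∧ vc.s = 0 ∧ vc.t = 0 ∧ vc • V' = V := by
  have hp0 : (p : ℚ_[p]) ^ 2 ≠ 0 := pow_ne_zero 2 (by exact_mod_cast (Fact.out : p.Prime).ne_zero)
  set U : ℚ_[p]ˣ := Units.mk0 ((p : ℚ_[p]) ^ 2) hp0 with hU
  refine ⟨(⟨U⁻¹, 0, 0, 0⟩ : VariableChange ℚ_[p]) • V, ⟨U, 0, 0, 0⟩, by rw [hU, Units.val_mk0], rfl, rfl, rfl, ?_⟩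
  rw [← mul_smul]
  have h1 : ((⟨U, 0, 0, 0⟩ : VariableChange ℚ_[p]) * ⟨U⁻¹, 0, 0, 0⟩) = 1 := by
    rw [VariableChange.mul_def, VariableChange.one_def]
    congr 1 <;> simp
  rw [h1, one_smul]

end Dilated

end Summit.BirchSwinnertonDyer.BirchSwinnertonDyer.Theorems.PSSigmaLineFamilyDilatedPair

end
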